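import Summits.HodgeConjecture.HodgeConjecture.Theorems.NikulinTwinTransportSectorComplement
import Literature.AlgebraicGeometry.HodgeTheory.MiddleDimensionReductionHolds
import Literature.AlgebraicGeometry.HodgeTheory.MotivatedClassesAlgebraic
import Literature.AlgebraicGeometry.HodgeTheory.HardLefschetzNFoldHolds
import Literature.AlgebraicGeometry.HodgeTheory.HodgeConjectureQbarVoisin
import Literature.AlgebraicGeometry.HodgeTheory.HodgeClassesDimLEThreeOfGAGA

/-!
# Strategy census for `NikulinTwinTransport.SectorComplement` (crux stmt-HodgeConjecture-13684) — typed objects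

Crux-strategist seat `planner-cstrat-stmt-HodgeConjecture-13684-0`, 2026-08-16. Companion of
`Cruxes/SectorComplement/STRATEGY-CENSUS.md` (same seat). The crux is the route's declared sector frame
`SectorComplement := SquareHodgeOfSqrtTwo → _root_.HodgeConjecture` (Σ := `SquareHodgeOfSqrtTwo`, the
K3-square-with-RM-√2 sector). Its truth table is LANDED (p84060,
`Theorems/NikulinTwinTransportSectorComplement.lean`: `HC → Σ`, `¬SectorComplement ↔ Σ ∧ ¬HC`,
`SectorComplement ↔ ¬Σ ∨ HC`, `HC ↔ Σ ∧ SectorComplement`) and is CITED here, never re-proved (a fourth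
propositional copy would be churn — `Ideator-13684-r2-k4.md` §6).

What this file adds, kernel-checked over the tree's REAL declarations (not propositional variables):

* §D1 the DEGREE split: `HodgeConjecture ↔ MiddleAll` (middle-degree classes on even-dimensional varieties),
  unconditionally, from the tree theorems `middleDimensionReduction_holds` (BFNP 2009 Lemma 48) and
  `nonempty_hodgeModel_holds`; hence `SectorComplement ↔ (Σ → MiddleAll)`, and for every cut `M` the law
  "given the low piece, the tail piece IS the crux" (`tail_iff_sectorComplement_of_low`).
* §D2 the ANDRÉ-SEAM split typed with `StandardConjectureBStar` / `motivatedClasses`: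
  `LefschetzBAll → HodgeIsMotivatedAll → SectorComplement` modulo the named fact
  `Andre1996_motivatedClasses_le_algebraicClasses_of_standardConjectureB` — with Σ UNUSED
  (`hodgeConjecture_of_andreSeam`), `HC → HodgeIsMotivatedAll` unconditionally
  (`algebraicClasses_le_motivatedClasses_of_nonempty_hardLefschetzNFold` + `nonempty_hardLefschetzNFold_holds`),
  so in the `B`-world the motivated piece IS the summit (`hodgeIsMotivatedAll_iff_hodgeConjecture_of_B`).
* §S the STRENGTHENING law: every HC-implied strengthening `S⁺` of the crux satisfies `S⁺ ∧ Σ ↔ HC`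
  (`strengthening_law`); two typed instances — the motivated summit (`MotivatedSummit`) and Voisin's
  `ℚ̄`-summit (`QbarSummit`, via `voisin2007_hodgeConjecture_weaklyAbsolute_of_qbar`) — each closing the
  SUMMIT outright, Σ unused.
* §N the NEGATION shape one step beyond p84060: modulo Serre's GAGA-for-line-cocycles fact, a refutation of
  the crux needs Σ AND a smooth projective variety of dimension ≥ 4 violating `HodgeConjectureFor`
  (`not_sectorComplement_shape`), i.e. the three siblings' engines (Lefschetz (1,1), hard Lefschetz, low
  dimension) are exactly what is already discharged.

Everything is sorry-free. Nothing here asserts a Theses decl.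
-/

set_option linter.dupNamespace false

namespace Summit.HodgeConjecture.HodgeConjecture.Cruxes.SectorComplement.StrategyCensus.NikulinTwinTransport

open Summit.HodgeConjecture.HodgeConjecture.Theses.NikulinTwinTransport
open Summit.HodgeConjecture.HodgeConjecture.Theorems
open Literature.AlgebraicGeometry.HodgeTheory Literature.AlgebraicGeometry.Motives
open CategoryTheory MonoidalCategory

/-! ## §D1 Decomposition by degree: the middle-dimensional reduction is a THEOREM of the tree -/

/-- `MiddleAll`: every rational middle-degree Hodge class on every even-dimensional smooth projective
complex variety is algebraic (BFNP 2009 Lemma 48's second bullet, cycle part). [cite: BrosnanFangNiePearlstein2009, Lemma 48] -/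
def MiddleAll : Prop :=
  ∀ ⦃m : ℕ⦄ ⦃X : SchemeOver ℂ⦄, IsSmoothProjective (2 * m) X →
    ∀ c : complexBetti X (2 * m), IsRationalClass c → IsOfHodgeType (2 * m) X (2 * m) m m c →
      c ∈ algebraicClasses X m

/-- Specialisation `p := m`. [folklore] -/
theorem middleAll_of_hodgeConjecture (h : _root_.HodgeConjecture) : MiddleAll :=
  fun m _ hX c hc hpp ↦ (h hX).2 m c hc hpp

/-- The non-trivial direction, UNCONDITIONAL in the tree: `middleDimensionReduction_holds` (products with
projective spaces below the middle, linear sections + weak Lefschetz above) and `nonempty_hodgeModel_holds`.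
[cite: BrosnanFangNiePearlstein2009, Lemma 48] -/
theorem hodgeConjecture_of_middleAll (h : MiddleAll) : _root_.HodgeConjecture :=
  fun _ _ hX ↦ hodgeConjectureFor_of_middleDimension middleDimensionReduction_holds
    (fun _ _ hY ↦ nonempty_hodgeModel_holds hY) h hX

/-- `HC ↔ MiddleAll`. [cite: BrosnanFangNiePearlstein2009, Lemma 48] -/
theorem hodgeConjecture_iff_middleAll : _root_.HodgeConjecture ↔ MiddleAll :=
  ⟨middleAll_of_hodgeConjecture, hodgeConjecture_of_middleAll⟩

/-- The crux in degree coordinates: `SectorComplement ↔ (Σ → MiddleAll)`. [folklore] -/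
theorem sectorComplement_iff_sector_imp_middleAll :
    SectorComplement ↔ (SquareHodgeOfSqrtTwo → MiddleAll) :=
  ⟨fun h hSig ↦ middleAll_of_hodgeConjecture (h hSig), fun h hSig ↦ hodgeConjecture_of_middleAll (h hSig)⟩

/-- The low piece of a cut at half-dimension `M`: middle classes on `2m`-folds, `m < M`. [folklore] -/
def MiddleBelow (M : ℕ) : Prop :=
  ∀ ⦃m : ℕ⦄ ⦃X : SchemeOver ℂ⦄, m < M → IsSmoothProjective (2 * m) X →
    ∀ c : complexBetti X (2 * m), IsRationalClass c → IsOfHodgeType (2 * m) X (2 * m) m m c →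
      c ∈ algebraicClasses X m

/-- The tail piece of the cut: middle classes on `2m`-folds, `M ≤ m`. [folklore] -/
def MiddleFrom (M : ℕ) : Prop :=
  ∀ ⦃m : ℕ⦄ ⦃X : SchemeOver ℂ⦄, M ≤ m → IsSmoothProjective (2 * m) X →
    ∀ c : complexBetti X (2 * m), IsRationalClass c → IsOfHodgeType (2 * m) X (2 * m) m m c →
      c ∈ algebraicClasses X m

/-- `MiddleAll ↔ MiddleBelow M ∧ MiddleFrom M` for every cut. [folklore] -/
theorem middleAll_iff_below_and_from (M : ℕ) : MiddleAll ↔ MiddleBelow M ∧ MiddleFrom M := by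
  constructor
  · exact fun h ↦ ⟨fun m X _ hX ↦ h hX, fun m X _ hX ↦ h hX⟩
  · rintro ⟨hb, hf⟩ m X hX
    by_cases hm : m < M
    · exact hb hm hX
    · exact hf (Nat.le_of_not_lt hm) hX

/-- THE TYPED DEGREE SPLIT of the crux: `(Σ → MiddleBelow M) → (Σ → MiddleFrom M) → SectorComplement`.
For `M = 2` the first piece is a theorem in print (m = 0: `H⁰`; m = 1: Lefschetz (1,1) on surfaces), so the
second piece is all of the content. [folklore] -/
theorem sectorComplement_of_degreeSplit (M : ℕ) (h₁ : SquareHodgeOfSqrtTwo → MiddleBelow M)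
    (h₂ : SquareHodgeOfSqrtTwo → MiddleFrom M) : SectorComplement :=
  sectorComplement_iff_sector_imp_middleAll.2 fun hSig ↦
    (middleAll_iff_below_and_from M).2 ⟨h₁ hSig, h₂ hSig⟩

/-- … and GIVEN the low piece, the tail piece IS the crux (no leverage: the residual of the split is the
whole crux again). [folklore] -/
theorem tail_iff_sectorComplement_of_low (M : ℕ) (h₁ : SquareHodgeOfSqrtTwo → MiddleBelow M) :
    (SquareHodgeOfSqrtTwo → MiddleFrom M) ↔ SectorComplement :=
  ⟨sectorComplement_of_degreeSplit M h₁,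
    fun h hSig ↦ ((middleAll_iff_below_and_from M).1 (middleAll_of_hodgeConjecture (h hSig))).2⟩

/-- The tail piece is itself a frame of the same shape: HC-implied, hence refutable only with `¬HC`.
[folklore] -/
theorem tail_of_hodgeConjecture (M : ℕ) (h : _root_.HodgeConjecture) :
    SquareHodgeOfSqrtTwo → MiddleFrom M :=
  fun _ ↦ ((middleAll_iff_below_and_from M).1 (middleAll_of_hodgeConjecture h)).2

/-! ## §D2 Decomposition along André's seam, typed with the tree's motivated classes -/

/-- Grothendieck's standard conjecture of Lefschetz type for ALL smooth projective complex varieties, in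
the tree's per-`(Z, η)` rendering `StandardConjectureBStar` (the Lefschetz involution of every
polarisation is an algebraic correspondence). Open (Kleiman 1968; Lieberman 1968 for abelian varieties).
[cite: Andre1996Motifs, §0.3] [cite: Grothendieck1968, §3] -/
def LefschetzBAll : Prop :=
  ∀ (d : ℕ) (Z : SchemeOver ℂ) (η : complexBetti Z 2), IsSmoothProjective d Z → StandardConjectureBStar d Z η

/-- "Every Hodge class is motivated" for ALL smooth projective complex varieties (André 1996 proves it
for abelian varieties, Thm. 0.6.2 = tree fact `Andre1996_hodgeClasses_abelianVariety_motivated`).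
[cite: Andre1996Motifs, Thm. 0.6.2 and §0.4] -/
def HodgeIsMotivatedAll : Prop :=
  ∀ ⦃n : ℕ⦄ ⦃X : SchemeOver ℂ⦄, IsSmoothProjective n X → ∀ (p : ℕ) (c : complexBetti X (2 * p)),
    IsRationalClass c → IsOfHodgeType n X (2 * p) p p c → c ∈ motivatedClasses n X p

/-- THE SEAM CLOSES THE SUMMIT (André): modulo the named fact "under `B`, motivated ⇒ algebraic",
`LefschetzBAll → HodgeIsMotivatedAll → HodgeConjecture`. [cite: Andre1996Motifs, §0.3–0.4 and §2.1] -/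
theorem hodgeConjecture_of_andreSeam
    (hA : Andre1996_motivatedClasses_le_algebraicClasses_of_standardConjectureB)
    (hB : LefschetzBAll) (hM : HodgeIsMotivatedAll) : _root_.HodgeConjecture :=
  fun _ _ hX ↦ ⟨nonempty_hodgeModel_holds hX, fun p c hc hpp ↦ hA hB hX p (hM hX p c hc hpp)⟩

/-- The typed André split of the crux — and the sector hypothesis is NOT used: the split is a
decomposition of the SUMMIT, not of this step. [cite: Andre1996Motifs, §0.4] -/
theorem sectorComplement_of_andreSeam
    (hA : Andre1996_motivatedClasses_le_algebraicClasses_of_standardConjectureB)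
    (hB : LefschetzBAll) (hM : HodgeIsMotivatedAll) : SectorComplement :=
  fun _ ↦ hodgeConjecture_of_andreSeam hA hB hM

/-- `HC → HodgeIsMotivatedAll`, UNCONDITIONALLY in the tree: algebraic classes are motivated
(`algebraicClasses_le_motivatedClasses_of_nonempty_hardLefschetzNFold`, the hard Lefschetz datum of
`X ⊗ X` being the theorem `nonempty_hardLefschetzNFold_holds`). [cite: Andre1996Motifs, §2.1 remark after Déf. 1] -/
theorem hodgeIsMotivatedAll_of_hodgeConjecture (h : _root_.HodgeConjecture) : HodgeIsMotivatedAll :=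
  fun _ _ hX p c hc hpp ↦
    algebraicClasses_le_motivatedClasses_of_nonempty_hardLefschetzNFold hX
      (nonempty_hardLefschetzNFold_holds _ _) p ((h hX).2 p c hc hpp)

/-- In the `B`-world the motivated piece IS the summit: `B → (HodgeIsMotivatedAll ↔ HC)` (modulo André's
fact). So the seam's second piece "remains the whole crux" exactly to the extent `B` is granted.
[cite: Andre1996Motifs, §0.4] -/
theorem hodgeIsMotivatedAll_iff_hodgeConjecture_of_B
    (hA : Andre1996_motivatedClasses_le_algebraicClasses_of_standardConjectureB) (hB : LefschetzBAll) :
    HodgeIsMotivatedAll ↔ _root_.HodgeConjecture :=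
  ⟨hodgeConjecture_of_andreSeam hA hB, hodgeIsMotivatedAll_of_hodgeConjecture⟩

/-- … and, granted that `B` delivers the sector (on paper: André 1996b motivated Kuga–Satake + Thm. 0.6.2,
`Ideator-13684-r1-k1.md` §2 — taken here as a hypothesis, not a tree fact), in the `B`-world the motivated
piece, the crux and the summit all coincide. [cite: Andre1996Motifs, §0.4] -/
theorem hodgeIsMotivatedAll_iff_sectorComplement_of_B
    (hA : Andre1996_motivatedClasses_le_algebraicClasses_of_standardConjectureB) (hB : LefschetzBAll)
    (hBSig : LefschetzBAll → SquareHodgeOfSqrtTwo) :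
    HodgeIsMotivatedAll ↔ SectorComplement :=
  (hodgeIsMotivatedAll_iff_hodgeConjecture_of_B hA hB).trans
    (nikulinTwinTransport_sectorComplement_iff_hodgeConjecture (hBSig hB)).symm

/-! ## §S Strengthenings: the law, and two typed instances -/

/-- THE STRENGTHENING LAW. Any `S⁺` that (i) implies the crux and (ii) is implied by HC (every "natural"
strengthening: motivated summit, `ℚ̄`-summit, enlarged-sector frames, uniform-in-families versions …)
satisfies `S⁺ ∧ Σ ↔ HC`: modulo the (HC-implied, open) sector it is the summit itself. [folklore] -/
theorem strengthening_law {S : Prop} (h₁ : S → SectorComplement) (h₂ : _root_.HodgeConjecture → S) :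
    S ∧ SquareHodgeOfSqrtTwo ↔ _root_.HodgeConjecture :=
  ⟨fun h ↦ h₁ h.1 h.2, fun h ↦ ⟨h₂ h, nikulinTwinTransport_squareHodgeOfSqrtTwo_of_hodgeConjecture h⟩⟩

/-- Conversely a strengthening NOT implied by HC is a bet beyond the summit; the only HC-free way into the
crux is `¬Σ`, which refutes HC (p84060). Recorded as the disjunction every `S⁺ → SectorComplement` proof
realises. [folklore] -/
theorem strengthening_dichotomy {S : Prop} (h₁ : S → SectorComplement) (hS : S) :
    ¬ SquareHodgeOfSqrtTwo ∨ _root_.HodgeConjecture :=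
  nikulinTwinTransport_sectorComplement_iff.1 (h₁ hS)

/-- S⁺₁, the MOTIVATED SUMMIT: `B` for all varieties ∧ Hodge ⇒ motivated for all varieties. -/
def MotivatedSummit : Prop := LefschetzBAll ∧ HodgeIsMotivatedAll

/-- S⁺₁ closes the summit (modulo André's fact), Σ unused. [cite: Andre1996Motifs, §0.4] -/
theorem hodgeConjecture_of_motivatedSummit
    (hA : Andre1996_motivatedClasses_le_algebraicClasses_of_standardConjectureB) (h : MotivatedSummit) :
    _root_.HodgeConjecture :=
  hodgeConjecture_of_andreSeam hA h.1 h.2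

/-- S⁺₂, VOISIN'S `ℚ̄`-SUMMIT: HC for every variety obtained by base change from `ℚ̄` ∧ every rational
`(p,p)`-class on every smooth projective complex variety is weakly absolute Hodge.
[cite: Voisin2007HodgeLoci, Prop. 1.2, Def. 2.1, Thm. 0.5] -/
def QbarSummit : Prop :=
  (∀ (σ : AlgebraicClosure ℚ →+* ℂ) ⦃n : ℕ⦄ ⦃X₀ : SchemeOver (AlgebraicClosure ℚ)⦄,
      IsSmoothProjective n ((baseChangeHom σ).obj X₀) → HodgeConjectureFor n ((baseChangeHom σ).obj X₀)) ∧
  (∀ ⦃n : ℕ⦄ ⦃X : SchemeOver ℂ⦄, IsSmoothProjective n X → ∀ (p : ℕ) (c : complexBetti X (2 * p)),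
      IsRationalClass c → IsOfHodgeType n X (2 * p) p p c → IsWeaklyAbsoluteHodgeClass n X p c)

/-- S⁺₂ closes the summit modulo Voisin 2007 Prop. 1.2 (tree fact), Σ unused.
[cite: Voisin2007HodgeLoci, Prop. 1.2] -/
theorem hodgeConjecture_of_qbarSummit (hV : voisin2007_hodgeConjecture_weaklyAbsolute_of_qbar)
    (h : QbarSummit) : _root_.HodgeConjecture :=
  fun _ _ hX ↦ ⟨nonempty_hodgeModel_holds hX, fun p c hc hpp ↦
    hodgeConjecture_weaklyAbsolute_of_hodgeConjectureFor_qbar hV h.1 hX (h.2 hX p c hc hpp)⟩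

/-- The first conjunct of S⁺₂ is HC-implied (a slice of the summit). [folklore] -/
theorem qbarSummit_fst_of_hodgeConjecture (h : _root_.HodgeConjecture) :
    ∀ (σ : AlgebraicClosure ℚ →+* ℂ) ⦃n : ℕ⦄ ⦃X₀ : SchemeOver (AlgebraicClosure ℚ)⦄,
      IsSmoothProjective n ((baseChangeHom σ).obj X₀) → HodgeConjectureFor n ((baseChangeHom σ).obj X₀) :=
  fun _ _ _ hX ↦ h hX

/-! ## §N Negation: the shape of a counterexample, one step beyond the landed truth table -/

/-- Modulo Serre's GAGA for line cocycles (tree fact; hard Lefschetz of threefolds is the theorem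
`nonempty_hardLefschetzNFold_holds`), a refutation of the crux must PROVE the sector AND exhibit a smooth
projective variety of dimension `≥ 4` violating `HodgeConjectureFor` — the siblings' engines (Lefschetz
(1,1), hard Lefschetz, dimension ≤ 3) are exactly what is already discharged; the honest counterexample
lives where no sibling reaches. [cite: VoisinHodgeII2003, §10.2.3 proof of Prop. 10.26] -/
theorem not_sectorComplement_shape (hG : serreGAGA_lineCocycle_iso_cartierDivisorCocycle)
    (h : ¬ SectorComplement) :
    SquareHodgeOfSqrtTwo ∧ ∃ (n : ℕ) (X : SchemeOver ℂ), IsSmoothProjective n X ∧ 4 ≤ n ∧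
      ¬ HodgeConjectureFor n X := by
  obtain ⟨hSig, hHC⟩ := nikulinTwinTransport_not_sectorComplement_iff.1 h
  refine ⟨hSig, ?_⟩
  by_contra hall
  apply hHC
  intro n X hX
  by_cases hn : n ≤ 3
  · exact hodgeConjectureFor_of_dim_le_three_of_serreGAGA hG
      (fun Y ↦ nonempty_hardLefschetzNFold_holds 3 Y) hn hX
  · by_contra hXn
    exact hall ⟨n, X, hX, by omega, hXn⟩

/-- Dually (degree coordinates of §D1): a refutation must exhibit a non-algebraic rational MIDDLE class on
an even-dimensional variety, together with the sector. Unconditional. [cite: BrosnanFangNiePearlstein2009, Lemma 48] -/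
theorem not_sectorComplement_middle_shape (h : ¬ SectorComplement) :
    SquareHodgeOfSqrtTwo ∧ ¬ MiddleAll :=
  let ⟨hSig, hHC⟩ := nikulinTwinTransport_not_sectorComplement_iff.1 h
  ⟨hSig, fun hm ↦ hHC (hodgeConjecture_of_middleAll hm)⟩

end Summit.HodgeConjecture.HodgeConjecture.Cruxes.SectorComplement.StrategyCensus.NikulinTwinTransport
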